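import Literature.AnabelianGeometry.SemiGraphs.SemiGraphLocal

/-!
# Semi-graphs: functoriality of the local semi-graphs `G[v]`, `G[e]` ([SemiAnbd] §1 p.13, §4 Def 4.1 (iv))

Mochizuki, *Semi-graphs of anabelioids*, Publ. RIMS **42** (2006), §1 p.13 (the local semi-graphs
`G[v] → G`, `G[e] → G`) and §4 Def 4.1 (iv) p.51 ("each of the induced morphisms `H[c] → H'[c']`
[where `c` is a component of `H` that maps to a component `c'` of `H'`]") (kurims
`paper:url-f33ace170ff4`). [cite: MochizukiSemiAnbd2006, Def 4.1 (iv), p. 51]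

CONSTRUCTION over t1's `SemiGraphLocal.lean` (merge step M4 part 3a of the L3 bridge, semi-graph
level): a morphism of semi-graphs `f : G → G'` induces morphisms of local semi-graphs
`G[v] → G'[f v]` (`atVertexMap`) and `G[e] → G'[f e]` (`atEdgeMap`) making the evident squares over
`G → G'` commute (`atVertexMap_comp_atVertexHom`, `atEdgeMap_comp_atEdgeHom`), functorially
(`atVertexMap_id`, `atVertexMap_comp`, `atEdgeMap_id`, `atEdgeMap_comp`).  These are the underlying
morphisms of semi-graphs of the induced morphisms `H[c] → H'[c']` of Def 4.1 (iv).  Nothing printed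
is asserted.
-/

namespace Literature.AnabelianGeometry.SemiGraphs

namespace SemiGraph

open CategoryTheory

universe u

variable {G G' G'' : SemiGraph.{u}}

/-! ### `G[v] → G'[f v]` -/

/-- The morphism `G[v] → G'[f v]` induced by `f : G → G'` (Def 4.1 (iv) "the induced morphisms
`H[c] → H'[c']`"): the vertex to the vertex, the edge `e'_b` (for a branch `b` abutting to `v`) to
`e'_{f b}`, branches by `f`. [cite: MochizukiSemiAnbd2006, Def 4.1 (iv), p. 51] -/
noncomputable def atVertexMap (f : G ⟶ G') (v : G.Vertex) :
    G.atVertex v ⟶ G'.atVertex (f.vertexMap v) where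
  vertexMap _ := PUnit.unit
  edgeMap p := Hom.starMap f v p
  branchMap q := ⟨(Hom.starMap f v q.1.1, f.branchMap q.1.2), by
    change G'.edgeOf (f.branchMap q.1.2) = G'.edgeOf (f.branchMap q.1.1.1)
    rw [f.edgeOf_branchMap, f.edgeOf_branchMap, q.2]⟩
  edgeOf_branchMap _ := rfl
  branchMap_injOn q₁ q₂ he h := by
    have h₂ : f.branchMap q₁.1.2 = f.branchMap q₂.1.2 := congrArg (fun x => x.1.2) h
    have he' : q₁.1.1 = q₂.1.1 := he
    refine Subtype.ext (Prod.ext he' (f.branchMap_injOn _ _ ?_ h₂))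
    rw [q₁.2, q₂.2, he']
  abuts_branchMap q u h := by
    have h' : q.1.2 = q.1.1.1 := (G.atVertex_abuts_eq_some_iff v q u).mp h
    exact (G'.atVertex_abuts_eq_some_iff _ _ _).mpr
      (by change f.branchMap q.1.2 = f.branchMap q.1.1.1; rw [h'])

/-- The square `G[v] → G'[f v] → G'` = `G[v] → G → G'` commutes.
[cite: MochizukiSemiAnbd2006, Def 4.1 (iv), p. 51] -/
theorem atVertexMap_comp_atVertexHom (f : G ⟶ G') (v : G.Vertex) :
    atVertexMap f v ≫ G'.atVertexHom (f.vertexMap v) = G.atVertexHom v ≫ f := by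
  refine hom_ext _ _ (funext fun _ => rfl) (funext fun p => ?_) (funext fun _ => rfl)
  exact f.edgeOf_branchMap p.1

/-- Functoriality: the identity induces the identity on `G[v]`.
[cite: MochizukiSemiAnbd2006, Def 4.1 (iv), p. 51] -/
theorem atVertexMap_id (v : G.Vertex) : atVertexMap (𝟙 G) v = 𝟙 (G.atVertex v) := by
  refine hom_ext _ _ (funext fun _ => rfl) (funext fun _ => rfl) (funext fun _ => rfl)

/-- Functoriality: composites induce composites on `G[v]`.
[cite: MochizukiSemiAnbd2006, Def 4.1 (iv), p. 51] -/
theorem atVertexMap_comp (f : G ⟶ G') (g : G' ⟶ G'') (v : G.Vertex) :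
    atVertexMap (f ≫ g) v = atVertexMap f v ≫ atVertexMap g (f.vertexMap v) := by
  refine hom_ext _ _ (funext fun _ => rfl) (funext fun _ => rfl) (funext fun _ => rfl)

/-! ### `G[e] → G'[f e]` -/

/-- The morphism `G[e] → G'[f e]` induced by `f : G → G'`: the edge to the edge, branches by `f`, the
vertex `v'_b` (for a branch `b` of `e` abutting to a vertex) to `v'_{f b}`.
[cite: MochizukiSemiAnbd2006, Def 4.1 (iv), p. 51] -/
noncomputable def atEdgeMap (f : G ⟶ G') (e : G.Edge) : G.atEdge e ⟶ G'.atEdge (f.edgeMap e) where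
  vertexMap w := ⟨f.branchMap w.1, by rw [f.edgeOf_branchMap, w.2.1], by
    rw [f.abuts_branchMap w.1 _ (Option.some_get w.2.2).symm]; rfl⟩
  edgeMap _ := PUnit.unit
  branchMap c := ⟨f.branchMap c.1, by rw [f.edgeOf_branchMap, c.2]⟩
  edgeOf_branchMap _ := rfl
  branchMap_injOn c₁ c₂ _ h :=
    Subtype.ext (f.branchMap_injOn _ _ (by rw [c₁.2, c₂.2]) (congrArg Subtype.val h))
  abuts_branchMap c w h := by
    rw [G.atEdge_abuts_eq_some_iff] at h
    exact (G'.atEdge_abuts_eq_some_iff _ _ _).mpr (by change f.branchMap c.1 = f.branchMap w.1; rw [h])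

/-- The square `G[e] → G'[f e] → G'` = `G[e] → G → G'` commutes.
[cite: MochizukiSemiAnbd2006, Def 4.1 (iv), p. 51] -/
theorem atEdgeMap_comp_atEdgeHom (f : G ⟶ G') (e : G.Edge) :
    atEdgeMap f e ≫ G'.atEdgeHom (f.edgeMap e) = G.atEdgeHom e ≫ f := by
  refine hom_ext _ _ (funext fun w => ?_) (funext fun _ => rfl) (funext fun _ => rfl)
  change (G'.abuts (f.branchMap w.1)).get _ = f.vertexMap ((G.abuts w.1).get w.2.2)
  have h := f.abuts_branchMap w.1 _ (Option.some_get w.2.2).symm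
  simp only [h, Option.get_some]

/-- Functoriality: the identity induces the identity on `G[e]`.
[cite: MochizukiSemiAnbd2006, Def 4.1 (iv), p. 51] -/
theorem atEdgeMap_id (e : G.Edge) : atEdgeMap (𝟙 G) e = 𝟙 (G.atEdge e) := by
  refine hom_ext _ _ (funext fun _ => rfl) (funext fun _ => rfl) (funext fun _ => rfl)

/-- Functoriality: composites induce composites on `G[e]`.
[cite: MochizukiSemiAnbd2006, Def 4.1 (iv), p. 51] -/
theorem atEdgeMap_comp (f : G ⟶ G') (g : G' ⟶ G'') (e : G.Edge) :
    atEdgeMap (f ≫ g) e = atEdgeMap f e ≫ atEdgeMap g (f.edgeMap e) := by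
  refine hom_ext _ _ (funext fun _ => rfl) (funext fun _ => rfl) (funext fun _ => rfl)

end SemiGraph

end Literature.AnabelianGeometry.SemiGraphs
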